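import Literature.Barriers.CriticalPhenomena.LaceExpansionXSpaceAsymptotics
import Literature.Probability.FitznerVanDerHofstad2017.MeanFieldOfTriangle
import HarnessLib

/-!
# `x`-space decay of the critical two-point function ⟹ the triangle condition ⟹ mean-field
# exponents (the positive half of the `3a ≷ 2d` criterion)

CITATION HEADER. Sources: T. Hara, R. van der Hofstad, G. Slade, *Critical two-point functions and
the lace expansion for spread-out high-dimensional percolation and related models*, Ann. Probab. 31
(2003) 349–408 = arXiv:math-ph/0011046 (bib key `HaraHofstadSlade2003`; held as
`lit paper:arxiv-math-ph_0011046`, page numbers = PDF pages of the arXiv version): Theorem 1.2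
(`τ_{p_c}(x) ~ const·|x|^{2-d}`) and, on p. 5, "the triangle condition … follows immediately from
Theorem 1.2 … for `d > 6`" via Proposition 1.7(i) (p. 7; proof §5, p. 20: the convolution of
`|x|^{-(d-2)}`-type bounds); M. Heydenreich, R. van der Hofstad, *Progress in high-dimensional
percolation and random graphs* (2017), proof of Cor. 5.2 (p. 56–57: the triangle is finite iff
`d > 2n`, `n = 3`, in `k`-space, and `p ↑ p_c` by monotone convergence); R. Fitzner, R. van der
Hofstad, EJP 22 (2017), Cor. 1.3 (triangle ⟹ mean-field exponents). Origin: build `lace`, unit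
`b2b-lace-dmps-g4` (fourth generation of the "DMPS route" seat). Companions:
`Literature.Barriers.CriticalPhenomena.not_triangleCondition_of_twoPoint_lower`
(`LaceExpansionHighDimension.lean`: the NEGATIVE half — a critical lower bound `τ_{p_c}(0,x) ≥ c‖x‖^{-a}`
with `3a ≤ 2d` makes the triangle diverge), `…GaussianDominationRoute.percolationContinuity_of_tau_le_rpow_subcrit`
(any subcritical-uniform power bound with `a > 0` gives `θ(p_c) = 0`),
`Literature.Probability.Percolation.InfraredBoundTriangle` (the `k`-space door: infrared bound ⟹ triangle,
`d ≥ 7`), `Literature.Probability.FitznerVanDerHofstad2017.meanField_of_triangle`.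

WHAT IS PROVED (kernel, no named facts).

* `triangleCondition_of_twoPoint_upper`: on `ℤ^d` (any `d`), if `τ_{p_c}(0,x) ≤ C‖x‖_∞^{-a}` for every
  `x ≠ 0` and `3a > 2d`, then `T(p_c) = Σ_{x,y} τ_{p_c}(0,x) τ_{p_c}(x,y) τ_{p_c}(y,0) < ∞`
  (`TriangleCondition d`). Together with `not_triangleCondition_of_twoPoint_lower` this is the sharp
  `x`-space criterion: for a two-point function squeezed between constant multiples of `‖x‖^{-a}`,
  the triangle condition holds iff `3a > 2d`; at the mean-field decay `a = d - 2` of Hara–van der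
  Hofstad–Slade / Hara (2008) this is `d > 6`.
* `triangleCondition_of_tau_le_rpow_subcrit`: the same from a bound `τ_p(0,x) ≤ C‖x‖_∞^{-a}` UNIFORM IN
  `p < p_c` (`d ≥ 1`), transferred to `p_c` by the tree's left-continuity lemma
  `tau_criticalProbI_le_of_forall_lt` — the form in which near-critical results (e.g. (1.26) of
  Duminil-Copin–Markar–Panis–Slade 2026, see `…DuminilCopinMarkarPanisSlade2026.MeanFieldDoor`) arrive.
* `meanField_of_twoPoint_upper`, `meanField_of_tau_le_rpow_subcrit`: hence (`d ≥ 2`) the four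
  mean-field exponent statements `MeanField d` (`θ(p_c) = 0`, `γ = 1`, `β = 1`, `δ = 2` in the
  bounded-ratio sense) by Fitzner–van der Hofstad Cor. 1.3 as proved in the tree
  (`meanField_of_triangle`).

PROOF (why no convolution estimate is needed). Write the summand, by translation invariance
(`tau_eq_tau_zero_sub`) and symmetry (`tau_comm`), as `τ(0,x) τ(0,y-x) τ(0,y) ≤ K³ ⟦x⟧^{-a} ⟦y-x⟧^{-a} ⟦y⟧^{-a}`
with Hara's regularised norm `⟦x⟧ = |x|₂ ∨ 1` (`jnorm`; `K = (C ∨ 0)(√d)^a + 1` absorbs `x = 0` and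
`|x|₂ ≤ √d ‖x‖_∞`). With `s = 3a/2 > d` and `f = ⟦·⟧^{-s} ∈ ℓ¹(ℤ^d)` (`summable_jnorm_rpow_neg`), the
inequality of geometric and arithmetic means (`Real.geom_mean_le_arith_mean3_weighted`, weights `1/3`)
gives POINTWISE
  `⟦x⟧^{-a} ⟦y-x⟧^{-a} ⟦y⟧^{-a} = (f(x)f(y-x))^{1/3} (f(x)f(y))^{1/3} (f(y-x)f(y))^{1/3}
     ≤ (f(x)f(y-x) + f(x)f(y) + f(y-x)f(y)) / 3`,
and each of the three products is summable over `(x,y) ∈ ℤ^d × ℤ^d` — `f ⊗ f` is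
(`Summable.mul_of_nonneg`), and the other two are `f ⊗ f` composed with the shears `(x,y) ↦ (x,y-x)`,
`(x,y) ↦ (y,y-x)` of `ℤ^d × ℤ^d` (`Equiv.summable_iff`). Comparison (`Summable.of_nonneg_of_le`)
finishes. (The textbook route — `Σ_y |y-x|^{-a}|y|^{-a} ≍ |x|^{d-2a}` for `d/2 < a < d`, then
`Σ_x |x|^{d-3a} < ∞` — needs the two-regime convolution estimate HvdHS03 Prop. 1.7(i); the GM–AM step
trades it for three product sums at the cost of nothing, since only finiteness is asserted.)

NO DIVERGENCE of statement: `TriangleCondition d` is the tree's (summability of the non-negative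
family over `ℤ^d × ℤ^d` at `p_c = criticalProbI d`, `TwoPointFunction.lean`), `‖·‖` is the sup norm of
`Site d = (Fin d → ℤ)` as in `not_triangleCondition_of_twoPoint_lower` and in
`percolationContinuity_of_tau_le_rpow_subcrit`; the threshold `3a > 2d` is the print's "`d > 2n`,
`n = 3`" at `a = d - 2`.
-/

noncomputable section

namespace Literature.Probability.Percolation

open Literature.Probability.LatticeModels
open Literature.Probability.FitznerVanDerHofstad2017 (MeanField meanField_of_triangle)
open Literature.Barriers.CriticalPhenomena (jnorm jnorm_pos one_le_jnorm jnorm_eq_euclidNorm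
  euclidNorm euclidNorm_nonneg norm_le_euclidNorm euclidNorm_le_sqrt_mul_norm summable_jnorm_rpow_neg
  tau_criticalProbI_le_of_forall_lt)

variable {d : ℕ}

/-! ### An elementary inequality -/

/-- **GM–AM for a triple product of pair products.** For `u, v, w > 0` and real `t`:
`u^{2t} v^{2t} w^{2t} ≤ (u^{3t}v^{3t} + u^{3t}w^{3t} + v^{3t}w^{3t})/3` — the geometric mean of the
three pair products `u^{3t}v^{3t}, u^{3t}w^{3t}, v^{3t}w^{3t}` is at most their arithmetic mean.
[folklore] -/
theorem rpow_triple_le_pairSum {u v w : ℝ} (hu : 0 < u) (hv : 0 < v) (hw : 0 < w) (t : ℝ) :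
    u ^ (2 * t) * v ^ (2 * t) * w ^ (2 * t) ≤
      (u ^ (3 * t) * v ^ (3 * t) + u ^ (3 * t) * w ^ (3 * t) + v ^ (3 * t) * w ^ (3 * t)) / 3 := by
  have hu3 : 0 ≤ u ^ (3 * t) := Real.rpow_nonneg hu.le _
  have hv3 : 0 ≤ v ^ (3 * t) := Real.rpow_nonneg hv.le _
  have hw3 : 0 ≤ w ^ (3 * t) := Real.rpow_nonneg hw.le _
  have key := Real.geom_mean_le_arith_mean3_weighted (w₁ := 1 / 3) (w₂ := 1 / 3) (w₃ := 1 / 3)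
    (p₁ := u ^ (3 * t) * v ^ (3 * t)) (p₂ := u ^ (3 * t) * w ^ (3 * t))
    (p₃ := v ^ (3 * t) * w ^ (3 * t)) (by norm_num) (by norm_num) (by norm_num)
    (mul_nonneg hu3 hv3) (mul_nonneg hu3 hw3) (mul_nonneg hv3 hw3) (by norm_num)
  have h3 : ∀ {z : ℝ}, 0 < z → (z ^ (3 * t)) ^ ((1 : ℝ) / 3) = z ^ t := fun hz => by
    rw [← Real.rpow_mul hz.le]
    congr 1
    ring
  have h2 : ∀ {z : ℝ}, 0 < z → z ^ t * z ^ t = z ^ (2 * t) := fun hz => by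
    rw [← Real.rpow_add hz]
    congr 1
    ring
  rw [Real.mul_rpow hu3 hv3, Real.mul_rpow hu3 hw3, Real.mul_rpow hv3 hw3, h3 hu, h3 hv, h3 hw]
    at key
  calc u ^ (2 * t) * v ^ (2 * t) * w ^ (2 * t)
      = u ^ t * v ^ t * (u ^ t * w ^ t) * (v ^ t * w ^ t) := by
        rw [← h2 hu, ← h2 hv, ← h2 hw]; ring
    _ ≤ 1 / 3 * (u ^ (3 * t) * v ^ (3 * t)) + 1 / 3 * (u ^ (3 * t) * w ^ (3 * t))
          + 1 / 3 * (v ^ (3 * t) * w ^ (3 * t)) := key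
    _ = _ := by ring

/-! ### Summability of the dominating family -/

/-- The three pair products of `f = ⟦·⟧^{-s}` along the triangle, `f(x)f(y-x) + f(x)f(y) + f(y-x)f(y)`,
form a summable family over `(x, y) ∈ ℤ^d × ℤ^d` as soon as `s > d`: `f ⊗ f` is summable
(lattice `p`-series, `summable_jnorm_rpow_neg`) and the other two terms are `f ⊗ f` composed with the
shears `(x,y) ↦ (x, y-x)` and `(x,y) ↦ (y, y-x)` of `ℤ^d × ℤ^d`. [folklore] -/
theorem summable_jnorm_rpow_neg_pairSum {s : ℝ} (hs : (d : ℝ) < s) :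
    Summable fun xy : Site d × Site d =>
      jnorm xy.1 ^ (-s) * jnorm (xy.2 - xy.1) ^ (-s) + jnorm xy.1 ^ (-s) * jnorm xy.2 ^ (-s)
        + jnorm (xy.2 - xy.1) ^ (-s) * jnorm xy.2 ^ (-s) := by
  have hf0 : ∀ x : Site d, 0 ≤ jnorm x ^ (-s) := fun x => Real.rpow_nonneg (jnorm_pos x).le _
  have hF : Summable fun xy : Site d × Site d => jnorm xy.1 ^ (-s) * jnorm xy.2 ^ (-s) :=
    (summable_jnorm_rpow_neg hs).mul_of_nonneg (summable_jnorm_rpow_neg hs) hf0 hf0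
  have hF' : Summable fun xy : Site d × Site d => jnorm xy.2 ^ (-s) * jnorm xy.1 ^ (-s) :=
    hF.congr fun xy => mul_comm _ _
  -- shear `(x, y) ↦ (x, y - x)`
  have h1 : Summable fun xy : Site d × Site d => jnorm xy.1 ^ (-s) * jnorm (xy.2 - xy.1) ^ (-s) :=
    ((((Equiv.refl (Site d)).prodShear fun x => Equiv.subRight x).summable_iff).2 hF).congr
      fun xy => rfl
  -- shear `(x, y) ↦ (y, y - x)`
  have h3 : Summable fun xy : Site d × Site d => jnorm (xy.2 - xy.1) ^ (-s) * jnorm xy.2 ^ (-s) :=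
    ((((Equiv.prodComm (Site d) (Site d)).trans
      ((Equiv.refl (Site d)).prodShear fun y => Equiv.subLeft y)).summable_iff).2 hF').congr
      fun xy => rfl
  exact (h1.add hF).add h3

/-! ### From the sup-norm power bound off the origin to a `⟦x⟧`-bound everywhere -/

/-- A bound `τ_{p_c}(0,x) ≤ C‖x‖_∞^{-a}` for `x ≠ 0` (`a ≥ 0`) gives `τ_{p_c}(0,x) ≤ K ⟦x⟧^{-a}` for
EVERY `x` with some `K ≥ 0` (`K = (C ∨ 0)(√d)^a + 1`: at `x = 0` both sides are compared with
`τ = 1 = ⟦0⟧`; off the origin `⟦x⟧ = |x|₂ ≤ √d‖x‖_∞`). [folklore] -/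
theorem exists_tau_criticalProbI_le_jnorm_rpow {a C : ℝ} (ha : 0 ≤ a)
    (hup : ∀ x : Site d, x ≠ 0 → tau d (criticalProbI d) 0 x ≤ C * ‖x‖ ^ (-a)) :
    ∃ K : ℝ, 0 ≤ K ∧ ∀ x : Site d, tau d (criticalProbI d) 0 x ≤ K * jnorm x ^ (-a) := by
  have hC0 : 0 ≤ max C 0 := le_max_right _ _
  have hsd0 : 0 ≤ Real.sqrt d := Real.sqrt_nonneg _
  have hK1 : 0 ≤ max C 0 * Real.sqrt d ^ a := mul_nonneg hC0 (Real.rpow_nonneg hsd0 _)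
  refine ⟨max C 0 * Real.sqrt d ^ a + 1, by linarith, fun x => ?_⟩
  have hjx : 0 < jnorm x := jnorm_pos x
  have hja : 0 ≤ jnorm x ^ (-a) := Real.rpow_nonneg hjx.le _
  by_cases hx : x = 0
  · subst hx
    have hj : jnorm (0 : Site d) = 1 := by
      simp [jnorm, euclidNorm]
    rw [tau_self, hj, Real.one_rpow, mul_one]
    linarith
  · -- `1 ≤ ‖x‖_∞` off the origin (integer coordinates; as `LongRangeIsing.one_le_norm_of_ne_zero`,
    -- inlined to keep the long-range-Ising integral machinery out of this module's imports)
    have hx1 : (1 : ℝ) ≤ ‖x‖ := by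
      obtain ⟨j, hj⟩ := Function.ne_iff.mp hx
      have h1 : (1 : ℝ) ≤ |((x j : ℤ) : ℝ)| := by
        rw [← Int.cast_abs]
        exact_mod_cast Int.one_le_abs hj
      exact h1.trans ((Int.norm_eq_abs (x j)).symm.trans_le (norm_le_pi_norm x j))
    have hxpos : (0 : ℝ) < ‖x‖ := lt_of_lt_of_le one_pos hx1
    have hjle : jnorm x ≤ Real.sqrt d * ‖x‖ := by
      rw [jnorm_eq_euclidNorm (hx1.trans (norm_le_euclidNorm x))]
      exact euclidNorm_le_sqrt_mul_norm x
    have hsd : 0 < Real.sqrt d := by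
      rcases hsd0.eq_or_lt with h0 | h0
      · exfalso
        rw [← h0, zero_mul] at hjle
        exact absurd hjle (not_le.2 hjx)
      · exact h0
    have hsda : 0 < Real.sqrt d ^ a := Real.rpow_pos_of_pos hsd _
    have hjpow : ‖x‖ ^ (-a) ≤ Real.sqrt d ^ a * jnorm x ^ (-a) := by
      have h1 : (Real.sqrt d * ‖x‖) ^ (-a) ≤ jnorm x ^ (-a) :=
        Real.rpow_le_rpow_of_nonpos hjx hjle (by linarith)
      rw [Real.mul_rpow hsd.le hxpos.le, Real.rpow_neg hsd.le] at h1
      calc ‖x‖ ^ (-a) = Real.sqrt d ^ a * ((Real.sqrt d ^ a)⁻¹ * ‖x‖ ^ (-a)) := by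
            rw [← mul_assoc, mul_inv_cancel₀ hsda.ne', one_mul]
        _ ≤ Real.sqrt d ^ a * jnorm x ^ (-a) := mul_le_mul_of_nonneg_left h1 hsda.le
    calc tau d (criticalProbI d) 0 x ≤ C * ‖x‖ ^ (-a) := hup x hx
      _ ≤ max C 0 * ‖x‖ ^ (-a) :=
          mul_le_mul_of_nonneg_right (le_max_left _ _) (Real.rpow_nonneg hxpos.le _)
      _ ≤ max C 0 * (Real.sqrt d ^ a * jnorm x ^ (-a)) := mul_le_mul_of_nonneg_left hjpow hC0
      _ = max C 0 * Real.sqrt d ^ a * jnorm x ^ (-a) := by ring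
      _ ≤ (max C 0 * Real.sqrt d ^ a + 1) * jnorm x ^ (-a) := by nlinarith

/-! ### The triangle condition from `x`-space decay -/

/-- **`x`-space decay ⟹ triangle condition (positive half of the `3a ≷ 2d` criterion).** On `ℤ^d`:
if `τ_{p_c}(0,x) ≤ C‖x‖_∞^{-a}` for every `x ≠ 0` with `3a > 2d`, then
`T(p_c) = Σ_{x,y} τ_{p_c}(0,x)τ_{p_c}(x,y)τ_{p_c}(y,0) < ∞` (`TriangleCondition d`). With the
companion `not_triangleCondition_of_twoPoint_lower` (`3a ≤ 2d`, lower bound ⟹ divergence) this is the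
`x`-space form of "the triangle is finite if (and only if) `d > 2n`, `n = 3`"; at the mean-field
decay `a = d - 2` it reads `d > 6`. Proof: GM–AM (`rpow_triple_le_pairSum`) bounds the summand
pointwise by `K³/3` times the summable pair-sum family `summable_jnorm_rpow_neg_pairSum` at
`s = 3a/2 > d`.
[cite: HaraHofstadSlade2003, Prop. 1.7(i) and p. 5 ("the triangle condition … follows immediately from Theorem 1.2 … for d > 6"); proof §5 (p. 20)]
[cite: HeydenreichVanDerHofstad2017, proof of Cor. 5.2, (5.1.9)–(5.1.12) (p. 56)] -/
theorem triangleCondition_of_twoPoint_upper {a C : ℝ} (ha : 2 * (d : ℝ) < 3 * a)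
    (hup : ∀ x : Site d, x ≠ 0 → tau d (criticalProbI d) 0 x ≤ C * ‖x‖ ^ (-a)) :
    TriangleCondition d := by
  have ha0 : 0 ≤ a := by
    have : (0 : ℝ) ≤ 2 * (d : ℝ) := by positivity
    linarith
  obtain ⟨K, hK0, hK⟩ := exists_tau_criticalProbI_le_jnorm_rpow ha0 hup
  set s : ℝ := 3 * a / 2 with hs_def
  have hs : (d : ℝ) < s := by rw [hs_def]; linarith
  refine Summable.of_nonneg_of_le triangle_summand_nonneg (fun xy => ?_)
    ((summable_jnorm_rpow_neg_pairSum hs).mul_left (K ^ 3 / 3))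
  obtain ⟨x, y⟩ := xy
  dsimp only
  rw [tau_eq_tau_zero_sub _ x y, tau_comm _ y 0]
  have hjx := jnorm_pos x
  have hjyx := jnorm_pos (y - x)
  have hjy := jnorm_pos y
  have key := rpow_triple_le_pairSum hjx hjyx hjy (-a / 2)
  have e2 : 2 * (-a / 2) = -a := by ring
  have e3 : 3 * (-a / 2) = -s := by rw [hs_def]; ring
  rw [e2, e3] at key
  have hKx : 0 ≤ K * jnorm x ^ (-a) := mul_nonneg hK0 (Real.rpow_nonneg hjx.le _)
  have hKy : 0 ≤ K * jnorm y ^ (-a) := mul_nonneg hK0 (Real.rpow_nonneg hjy.le _)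
  calc tau d (criticalProbI d) 0 x * tau d (criticalProbI d) 0 (y - x) * tau d (criticalProbI d) 0 y
      ≤ K * jnorm x ^ (-a) * (K * jnorm (y - x) ^ (-a)) * (K * jnorm y ^ (-a)) :=
        mul_le_mul (mul_le_mul (hK x) (hK (y - x)) (tau_nonneg _ _ _) hKx) (hK y)
          (tau_nonneg _ _ _) (mul_nonneg hKx (mul_nonneg hK0 (Real.rpow_nonneg hjyx.le _)))
    _ = K ^ 3 * (jnorm x ^ (-a) * jnorm (y - x) ^ (-a) * jnorm y ^ (-a)) := by ring
    _ ≤ K ^ 3 * ((jnorm x ^ (-s) * jnorm (y - x) ^ (-s) + jnorm x ^ (-s) * jnorm y ^ (-s)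
          + jnorm (y - x) ^ (-s) * jnorm y ^ (-s)) / 3) :=
        mul_le_mul_of_nonneg_left key (pow_nonneg hK0 3)
    _ = K ^ 3 / 3 * (jnorm x ^ (-s) * jnorm (y - x) ^ (-s) + jnorm x ^ (-s) * jnorm y ^ (-s)
          + jnorm (y - x) ^ (-s) * jnorm y ^ (-s)) := by ring

/-- **Subcritical-uniform form.** On `ℤ^d`, `d ≥ 1`: a power bound `τ_p(0,x) ≤ C‖x‖_∞^{-a}` valid for
all `p < p_c` and all `x ≠ 0`, with `3a > 2d`, gives the triangle condition at `p_c` — the bound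
passes to `p = p_c` for each fixed `x` by left-continuity (`tau_criticalProbI_le_of_forall_lt`:
`τ_{p_c}(0,x) = sup_n P_{p_c}(0 ↔ x in Λ_n)`, each box term continuous in `p`), then
`triangleCondition_of_twoPoint_upper`. This is the `x`-space analogue of the `p ↑ p_c` step in the
`k`-space derivation of the triangle condition from the infrared bound.
[cite: HeydenreichVanDerHofstad2017, proof of Cor. 5.2, (5.1.17) (p. 57: uniform bound for p < p_c, then monotone convergence)]
[cite: HaraHofstadSlade2003, Prop. 1.7(i), p. 5] -/
theorem triangleCondition_of_tau_le_rpow_subcrit (hd : 1 ≤ d) {a C : ℝ} (ha : 2 * (d : ℝ) < 3 * a)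
    (h : ∀ p : unitInterval, (p : ℝ) < criticalProb (zdGraph d) (0 : Site d) →
      ∀ x : Site d, x ≠ 0 → tau d p 0 x ≤ C * ‖x‖ ^ (-a)) :
    TriangleCondition d :=
  triangleCondition_of_twoPoint_upper ha fun x hx =>
    tau_criticalProbI_le_of_forall_lt hd x fun p hp => h p hp x hx

/-! ### Mean-field exponents -/

/-- **`x`-space decay ⟹ mean-field behaviour.** On `ℤ^d`, `d ≥ 2`: `τ_{p_c}(0,x) ≤ C‖x‖_∞^{-a}` off
the origin with `3a > 2d` gives `MeanField d` — `θ(p_c) = 0`, `γ = 1`, `β = 1` and `δ = 2` in the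
bounded-ratio sense — by the triangle condition (`triangleCondition_of_twoPoint_upper`) and
Fitzner–van der Hofstad Cor. 1.3 as proved in the tree (`meanField_of_triangle`: Aizenman–Newman,
Barsky–Aizenman). [cite: FitznerVanDerHofstad2017, Cor. 1.3]
[cite: HaraHofstadSlade2003, p. 5 (Theorem 1.2 ⟹ triangle condition ⟹ mean-field critical exponents, via [2], [5])] -/
theorem meanField_of_twoPoint_upper (hd : 2 ≤ d) {a C : ℝ} (ha : 2 * (d : ℝ) < 3 * a)
    (hup : ∀ x : Site d, x ≠ 0 → tau d (criticalProbI d) 0 x ≤ C * ‖x‖ ^ (-a)) : MeanField d :=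
  meanField_of_triangle hd (triangleCondition_of_twoPoint_upper ha hup)

/-- **Subcritical-uniform `x`-space decay ⟹ mean-field behaviour** (`d ≥ 2`): a bound
`τ_p(0,x) ≤ C‖x‖_∞^{-a}` for all `p < p_c`, `x ≠ 0`, with `3a > 2d`, gives `MeanField d`.
[cite: FitznerVanDerHofstad2017, Cor. 1.3] [cite: HeydenreichVanDerHofstad2017, proof of Cor. 5.2 (p. 57)] -/
theorem meanField_of_tau_le_rpow_subcrit (hd : 2 ≤ d) {a C : ℝ} (ha : 2 * (d : ℝ) < 3 * a)
    (h : ∀ p : unitInterval, (p : ℝ) < criticalProb (zdGraph d) (0 : Site d) →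
      ∀ x : Site d, x ≠ 0 → tau d p 0 x ≤ C * ‖x‖ ^ (-a)) : MeanField d :=
  meanField_of_triangle hd (triangleCondition_of_tau_le_rpow_subcrit (by omega) ha h)

/-- **The sharp `x`-space criterion, both halves in one statement.** If the critical two-point
function is squeezed, `c‖x‖_∞^{-a} ≤ τ_{p_c}(0,x) ≤ C‖x‖_∞^{-a}` for `x ≠ 0` with `c > 0`, `a ≥ 0`
(`d ≥ 1`), then the triangle condition holds if and only if `3a > 2d`.
[cite: HeydenreichVanDerHofstad2017, proof of Cor. 5.2 (p. 56: "finite if (and only if) d > 2n")]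
[cite: ChayesChayes1987, Introduction (p. 28: "γ = 1 whenever d + 3η - 6 > 0")] -/
theorem triangleCondition_iff_of_twoPoint_squeeze (hd : 1 ≤ d) {a c C : ℝ} (ha0 : 0 ≤ a)
    (hc : 0 < c)
    (hlow : ∀ x : Site d, x ≠ 0 → c * ‖x‖ ^ (-a) ≤ tau d (criticalProbI d) 0 x)
    (hup : ∀ x : Site d, x ≠ 0 → tau d (criticalProbI d) 0 x ≤ C * ‖x‖ ^ (-a)) :
    TriangleCondition d ↔ 2 * (d : ℝ) < 3 * a := by
  refine ⟨fun hT => ?_, fun ha => triangleCondition_of_twoPoint_upper ha hup⟩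
  by_contra hle
  exact Literature.Barriers.CriticalPhenomena.not_triangleCondition_of_twoPoint_lower hd ha0
    (not_lt.1 hle) hc hlow hT

end Literature.Probability.Percolation

end
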